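import Literature.NumberTheory.Rogawski1990.ArchUnitaryPlaneEigenframeCompact   -- ★ `isCompact_setOf_norm_apply_le_and_inv` (any `N`); the rank-2 engine this file twins
import Literature.NumberTheory.Rogawski1990.StableClassesSplitTorus              -- ★ `sub_one_mul_frameGram_apply_eq_zero` (zero pattern of the frame Gram matrix)
import Literature.LinearAlgebra.Matrix.Diagonalization                            -- ★ `exists_conj_eq_diagonal_of_nodup_roots'` (Horn–Johnson Thm 1.3.9)
import Mathlib.Data.Matrix.PEquiv
import Mathlib.Analysis.Complex.Basic
import Mathlib.Topology.Instances.Matrix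
import Mathlib.Topology.Algebra.Constructions
import HarnessLib

/-!
# Regular semisimple elements of `U(2,1) = U(Φ₃)(ℂ)` with bounded eigenvalues are `GL₃(ℂ)`-conjugate into ONE compact subset of `U(Φ₃)(ℂ)`
(the two Cartan subgroups of `U(2,1)`: Rogawski 1990 §3.6 p. 31, types (0) and (1); the «bounded modulo `Z(ℝ)`» clause of Shelstad 2012, Cor. 2.2)

Topic `NumberTheory/Rogawski1990`; namespace `Literature.NumberTheory.Rogawski1990`.  THEOREMS ONLY (no definition, no instance, no notation,
no axiom, no named fact, no `sorry`).  Cell `pub/hodgecm-mathlib`, F0∕P3c line LH2 (crux H413 = `stmt-HodgeConjecture-24833`, closer stub `stub_N8` =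
★ `Rogawski1990.ArchInnerTransferCompatible`, organ (Sh) `stub_N8one` of the pay-down skeleton `StubN8.paydown.skeleton.v2`): the complex-linear-algebra
ENGINE, rank 3, of the sub-lemma (EIG→CPT) «a regular `γ ∈ G_∞ = U(Φ₃)(L⁺ ⊗ ℝ)` whose correspondents `γ′ ↔ γ` meet a compact set is stably conjugate into a
compact subset of `G_∞`» of the organ «TRANSFER SIDE BOUNDED, INNER» (the `C_c^∞`-replacement road to (Sh): Shelstad's Schwartz transfer + Bouaziz).  It is
the exact `U(2,1)` twin of the rank-2 engine ★ `exists_isCompact_forall_isConj_of_mem_unitaryGroupOfForm_antidiag_two` (`ArchUnitaryPlaneEigenframeCompact`, line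
LH3), whose §1 (`isCompact_setOf_norm_apply_le_and_inv`, any `N`) is imported, not restated.

THE MATHEMATICS.  `Φ₃ = antidiag(1, 1, 1)`, `U(Φ₃)(ℂ) = {g ∈ GL₃(ℂ) ∣ ḡᵀ Φ₃ g = Φ₃} ≅ U(2,1)`.  Let `g ∈ U(Φ₃)(ℂ)` be regular semisimple (separable
characteristic polynomial) with all eigenvalues of absolute value `≤ R`.  Diagonalise `g = S · diag(d₀, d₁, d₂) · S⁻¹` in `GL₃(ℂ)` (★ Horn–Johnson 1.3.9).  The
Gram matrix `Q = S̄ᵀ Φ₃ S` of the form in the eigenframe satisfies `(d̄ᵢ dⱼ − 1) Qᵢⱼ = 0` (★ `sub_one_mul_frameGram_apply_eq_zero`) and `det Q ≠ 0`; hence no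
row of `Q` vanishes, i.e. EVERY index `i` has a PARTNER `j` with `d̄ᵢ dⱼ = 1`; partners are unique (the `dᵢ` are distinct) and the relation is symmetric, so
`i ↦ j` is an involution of `{0, 1, 2}`.  EITHER it is the identity — `|d₀| = |d₁| = |d₂| = 1`, the COMPACT Cartan `T_c ≅ U(1)³` (type (1)): `g` is conjugate to
the block matrix `M(d₀, d₁, d₂) = ½ (d₀+d₂, 0, d₀−d₂; 0, 2d₁, 0; d₀−d₂, 0, d₀+d₂) = P · diag(d) · P⁻¹ ∈ U(Φ₃)(ℂ)`, `P = (1,0,1; 0,1,0; 1,0,−1)` (the rank-2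
★ `torusMatrix d₀ d₂` on the isotropic pair of coordinates `{0, 2}`, `d₁` on the anisotropic line) — OR it has exactly one fixed point `l` (`|d_l| = 1`) and
swaps the other two `k, j` (`d_j = d̄_k⁻¹`, so `|d_k| · |d_j| = 1` and `R⁻¹ ≤ |d_k|, |d_j| ≤ R`), the Cartan `T_s ≅ ℂˣ × U(1)` (type (0)): `g` is conjugate, by
a permutation matrix, to `diag(d_k, d_l, d_j)`, which lies in `U(Φ₃)(ℂ)` (`ā c = 1`, `b̄ b = 1` for `diag(a, b, c)`).  In both cases the representative and its
inverse have all entries of absolute value `≤ max R 1`, and the set of such elements of the closed subgroup `U(Φ₃)(ℂ)` is compact (★ §1 of the rank-2 file).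
An UPPER bound on the eigenvalues suffices: unitarity pairs `λ ↔ λ̄⁻¹`.

* §1 `exists_units_diagonal_comp_perm` — permuting the eigenvalues of a diagonal unit is a `GL_n(ℂ)`-conjugation (permutation matrices, any `n`).
* §2 `compactTorusRep₃_mul ∕ _one ∕ conjTranspose_compactTorusRep₃_mul ∕ norm_compactTorusRep₃_apply_le_one` — the block representative
  `M(u₀, u₁, u₂)` of the compact Cartan: multiplicative, unitary for `Φ₃` when `|uᵢ| = 1`, entries of absolute value `≤ 1` (written out, no `def`).
* §3 **`exists_isCompact_forall_isConj_of_mem_unitaryGroupOfForm_antidiag_three`** — the engine: for every `R` ONE compact `C ⊆ U(Φ₃)(ℂ)` receives, up to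
  `GL₃(ℂ)`-conjugacy (= stable conjugacy, [Rogawski1990 §3.1 p. 19]), every regular semisimple `g ∈ U(Φ₃)(ℂ)` whose eigenvalues have absolute value `≤ R`.
NOT HERE: the number-field dress (`G_∞ = U(Φ₃)(L⁺ ⊗ ℝ) ≤ GL₃(L ⊗ ℝ)`, place by place via ★ `placeGL` ∕ `archAt`) and the orbital-integral reading — they belong
to the organ file «transfer side bounded, inner».
HONEST LABEL: HC_CM is proved only modulo the 7 printed citations (2 remaining: hLiu418, h413) until rung 0 closes; this file is linear algebra and pays
nothing by itself.

## References
* [Rogawski1990] J. D. Rogawski, *Automorphic Representations of Unitary Groups in Three Variables*, Ann. of Math. Stud. 123 (1990), §3.1 p. 19 (stable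
  conjugacy = `GL_n`-conjugacy), §3.6 p. 31 (classification of the Cartan subgroups of a unitary group in 3 variables: over `ℝ` only types (0)
  `(G_m)_{ℂ∕ℝ} × U(1)` and (1) `U(1)³` occur).
* [Knapp1986] A. W. Knapp, *Representation Theory of Semisimple Groups*, PMS 36 (1986), Ch. V §3 (Cartan subgroups of `SU(2,1)`).
* [Shelstad2012] D. Shelstad, *On geometric transfer in real twisted endoscopy*, Ann. of Math. 176 (2012), Cor. 2.2 p. 1926 («vanish off the conjugacy classes
  meeting a set … bounded modulo `Z₁(ℝ)`»).
* [HornJohnson2013] R. A. Horn, C. R. Johnson, *Matrix Analysis*, 2nd ed. (2013), Thm 1.3.9 (distinct eigenvalues ⇒ diagonalisable).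
-/

set_option autoImplicit false

noncomputable section

open Matrix Topology Polynomial
open Literature.NumberTheory.Automorphic (unitaryGroupOfForm mem_unitaryGroupOfForm_iff)
open scoped MatrixGroups ComplexConjugate

namespace Literature.NumberTheory.Rogawski1990

/-! ## §1 Permuting the eigenvalues of a diagonal unit is a `GL_n(ℂ)`-conjugation -/

section DiagonalPerm

variable {n : Type*} [Fintype n] [DecidableEq n]

/-- **Permuted diagonal units are conjugate.**  If `D ∈ GL_n(ℂ)` has matrix `diag(d)` and inverse matrix `diag(e)`, then for every permutation `σ` there is
`δ ∈ GL_n(ℂ)` with matrix `diag(d ∘ σ)`, inverse matrix `diag(e ∘ σ)`, and `D ∼ δ` — conjugation by the permutation matrix of `σ`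
(`P_σ · diag(d) · P_σ⁻¹ = diag(d ∘ σ)`). [folklore] [cite: HornJohnson2013, Thm 1.3.9] -/
theorem exists_units_diagonal_comp_perm (D : GL n ℂ) {d e : n → ℂ}
    (hD : (D : Matrix n n ℂ) = diagonal d) (hDinv : ((D⁻¹ : GL n ℂ) : Matrix n n ℂ) = diagonal e) (σ : Equiv.Perm n) :
    ∃ δ : GL n ℂ, (δ : Matrix n n ℂ) = diagonal (d ∘ σ) ∧ ((δ⁻¹ : GL n ℂ) : Matrix n n ℂ) = diagonal (e ∘ σ) ∧ IsConj D δ := by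
  -- the permutation matrix of `σ` as a unit of `M_n(ℂ)`
  have h1 : (σ.toPEquiv.toMatrix : Matrix n n ℂ) * σ.symm.toPEquiv.toMatrix = 1 := by
    rw [← PEquiv.toMatrix_trans, ← Equiv.toPEquiv_trans, Equiv.self_trans_symm, Equiv.toPEquiv_refl, PEquiv.toMatrix_refl]
  have h2 : (σ.symm.toPEquiv.toMatrix : Matrix n n ℂ) * σ.toPEquiv.toMatrix = 1 := by
    rw [← PEquiv.toMatrix_trans, ← Equiv.toPEquiv_trans, Equiv.symm_trans_self, Equiv.toPEquiv_refl, PEquiv.toMatrix_refl]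
  set P : GL n ℂ := ⟨σ.toPEquiv.toMatrix, σ.symm.toPEquiv.toMatrix, h1, h2⟩ with hP
  have hPval : ((P : GL n ℂ) : Matrix n n ℂ) = σ.toPEquiv.toMatrix := rfl
  have hPinv : ((P⁻¹ : GL n ℂ) : Matrix n n ℂ) = σ.symm.toPEquiv.toMatrix := rfl
  -- `P_σ · diag(f) · P_σ⁻¹ = diag(f ∘ σ)`
  have key : ∀ f : n → ℂ, (σ.toPEquiv.toMatrix : Matrix n n ℂ) * diagonal f * σ.symm.toPEquiv.toMatrix = diagonal (f ∘ σ) := by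
    intro f
    rw [PEquiv.toMatrix_toPEquiv_mul, PEquiv.mul_toMatrix_toPEquiv, Equiv.symm_symm, submatrix_submatrix,
      Function.comp_id, Function.id_comp, submatrix_diagonal_equiv]
  refine ⟨P * D * P⁻¹, ?_, ?_, isConj_iff.2 ⟨P, rfl⟩⟩
  · rw [Units.val_mul, Units.val_mul, hPval, hPinv, hD]
    exact key d
  · rw [_root_.mul_inv_rev, _root_.mul_inv_rev, inv_inv, ← mul_assoc, Units.val_mul, Units.val_mul, hPval, hPinv, hDinv]
    exact key e

end DiagonalPerm

/-! ## §2 The block representative `M(u₀, u₁, u₂)` of the compact Cartan of `U(Φ₃)(ℂ)` (written out; `torusMatrix u₀ u₂` on the coordinates `{0, 2}`, `u₁` at `(1,1)`) -/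

section CompactTorusRep

/-- **Multiplicativity** `M(u) · M(v) = M(u v)` (conjugates of diagonal matrices by the SAME frame `P = (1,0,1; 0,1,0; 1,0,−1)`).
[cite: Rogawski1990, §3.6 p. 31] -/
theorem compactTorusRep₃_mul (u₀ u₁ u₂ v₀ v₁ v₂ : ℂ) :
    (!![(u₀ + u₂) / 2, 0, (u₀ - u₂) / 2; 0, u₁, 0; (u₀ - u₂) / 2, 0, (u₀ + u₂) / 2] : Matrix (Fin 3) (Fin 3) ℂ) *
        !![(v₀ + v₂) / 2, 0, (v₀ - v₂) / 2; 0, v₁, 0; (v₀ - v₂) / 2, 0, (v₀ + v₂) / 2] =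
      !![(u₀ * v₀ + u₂ * v₂) / 2, 0, (u₀ * v₀ - u₂ * v₂) / 2; 0, u₁ * v₁, 0; (u₀ * v₀ - u₂ * v₂) / 2, 0, (u₀ * v₀ + u₂ * v₂) / 2] := by
  ext i j
  fin_cases i <;> fin_cases j <;> simp [Matrix.mul_apply, Fin.sum_univ_three] <;> ring

/-- `M(1, 1, 1) = 1`. [cite: Rogawski1990, §3.6 p. 31] -/
theorem compactTorusRep₃_one :
    (!![((1 : ℂ) + 1) / 2, 0, ((1 : ℂ) - 1) / 2; 0, 1, 0; ((1 : ℂ) - 1) / 2, 0, ((1 : ℂ) + 1) / 2] : Matrix (Fin 3) (Fin 3) ℂ) = 1 := by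
  ext i j
  fin_cases i <;> fin_cases j <;> simp

/-- **`M(u₀, u₁, u₂) ∈ U(Φ₃)(ℂ)` when `ūᵢ uᵢ = 1`**: `M̄ᵀ Φ₃ M = Φ₃` for `Φ₃ = antidiag(1,1,1)` (the compact Cartan `T_c ≅ U(1)³`, type (1)).
[cite: Rogawski1990, §3.6 p. 31] -/
theorem conjTranspose_compactTorusRep₃_mul {u₀ u₁ u₂ : ℂ}
    (h₀ : starRingEnd ℂ u₀ * u₀ = 1) (h₁ : starRingEnd ℂ u₁ * u₁ = 1) (h₂ : starRingEnd ℂ u₂ * u₂ = 1) :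
    ((!![(u₀ + u₂) / 2, 0, (u₀ - u₂) / 2; 0, u₁, 0; (u₀ - u₂) / 2, 0, (u₀ + u₂) / 2] : Matrix (Fin 3) (Fin 3) ℂ).map (starRingEnd ℂ))ᵀ *
        (Matrix.of fun i j : Fin 3 => if i.val + j.val + 1 = 3 then (1 : ℂ) else 0) *
        !![(u₀ + u₂) / 2, 0, (u₀ - u₂) / 2; 0, u₁, 0; (u₀ - u₂) / 2, 0, (u₀ + u₂) / 2] =
      Matrix.of fun i j : Fin 3 => if i.val + j.val + 1 = 3 then (1 : ℂ) else 0 := by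
  have hσ2 : starRingEnd ℂ (2 : ℂ) = 2 := map_ofNat _ 2
  ext i j
  fin_cases i <;> fin_cases j <;>
    simp [Matrix.mul_apply, Fin.sum_univ_three, Matrix.of_apply, map_div₀, hσ2]
  · linear_combination (h₀ - h₂) / 2
  · linear_combination (h₀ + h₂) / 2
  · linear_combination h₁
  · linear_combination (h₀ + h₂) / 2
  · linear_combination (h₀ - h₂) / 2

/-- For `|uᵢ| = 1` every entry of `M(u₀, u₁, u₂)` has absolute value `≤ 1`. [cite: Rogawski1990, §3.6 p. 31] -/
theorem norm_compactTorusRep₃_apply_le_one {u₀ u₁ u₂ : ℂ} (h₀ : ‖u₀‖ = 1) (h₁ : ‖u₁‖ = 1) (h₂ : ‖u₂‖ = 1) (i j : Fin 3) :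
    ‖(!![(u₀ + u₂) / 2, 0, (u₀ - u₂) / 2; 0, u₁, 0; (u₀ - u₂) / 2, 0, (u₀ + u₂) / 2] : Matrix (Fin 3) (Fin 3) ℂ) i j‖ ≤ 1 := by
  have hadd : ‖u₀ + u₂‖ / 2 ≤ 1 := by
    have := norm_add_le u₀ u₂
    rw [h₀, h₂] at this
    linarith
  have hsub : ‖u₀ - u₂‖ / 2 ≤ 1 := by
    have := norm_sub_le u₀ u₂
    rw [h₀, h₂] at this
    linarith
  fin_cases i <;> fin_cases j <;> simp <;> first | exact hadd | exact hsub | exact h₁.le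

end CompactTorusRep

/-! ## §3 The engine: regular semisimple elements of `U(Φ₃)(ℂ)` with bounded eigenvalues, up to `GL₃(ℂ)`-conjugacy, in ONE compact set -/

section Engine

/-- **(EIG→CPT), complex engine, rank 3.**  For every `R` there is a COMPACT `C ⊆ U(Φ₃)(ℂ)` (`Φ₃ = antidiag(1,1,1)`, `U(Φ₃)(ℂ) ≅ U(2,1)`) such that every
regular semisimple `g ∈ U(Φ₃)(ℂ)` all of whose eigenvalues have absolute value `≤ R` is `GL₃(ℂ)`-conjugate (= stably conjugate) to an element of `C`:
`C = {δ ∈ U(Φ₃)(ℂ) ∣ |δᵢⱼ|, |(δ⁻¹)ᵢⱼ| ≤ max R 1}` receives the type-(0) representative `diag(d_k, d_l, d̄_k⁻¹)` (`|d_l| = 1`, `R⁻¹ ≤ |d_k| ≤ R`) or the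
type-(1) representative `M(d₀, d₁, d₂)` (`|dᵢ| = 1`) of `g`, according to the involution «`d̄ᵢ dⱼ = 1`» on the eigenvalue indices read off the zero pattern
of the frame Gram matrix of `Φ₃`. [cite: Rogawski1990, §3.6 p. 31; §3.1 p. 19] [cite: Knapp1986, Ch. V §3] [cite: Shelstad2012, Cor. 2.2 p. 1926] -/
theorem exists_isCompact_forall_isConj_of_mem_unitaryGroupOfForm_antidiag_three (R : ℝ) :
    ∃ C : Set (GL (Fin 3) ℂ), IsCompact C ∧
      C ⊆ (unitaryGroupOfForm (starRingEnd ℂ) (Matrix.of fun i j : Fin 3 => if i.val + j.val + 1 = 3 then (1 : ℂ) else 0) : Set (GL (Fin 3) ℂ)) ∧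
      ∀ g : GL (Fin 3) ℂ, g ∈ unitaryGroupOfForm (starRingEnd ℂ) (Matrix.of fun i j : Fin 3 => if i.val + j.val + 1 = 3 then (1 : ℂ) else 0) →
        (g : Matrix (Fin 3) (Fin 3) ℂ).charpoly.Separable →
        (∀ z : ℂ, (g : Matrix (Fin 3) (Fin 3) ℂ).charpoly.IsRoot z → ‖z‖ ≤ R) →
          ∃ δ ∈ C, IsConj g δ := by
  classical
  set J : Matrix (Fin 3) (Fin 3) ℂ := Matrix.of fun i j : Fin 3 => if i.val + j.val + 1 = 3 then (1 : ℂ) else 0 with hJ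
  have hJ00 : J 0 0 = 0 := rfl
  have hJ01 : J 0 1 = 0 := rfl
  have hJ02 : J 0 2 = 1 := rfl
  have hJ10 : J 1 0 = 0 := rfl
  have hJ11 : J 1 1 = 1 := rfl
  have hJ12 : J 1 2 = 0 := rfl
  have hJ20 : J 2 0 = 1 := rfl
  have hJ21 : J 2 1 = 0 := rfl
  have hJ22 : J 2 2 = 0 := rfl
  have hJdet : J.det = -1 := by
    rw [Matrix.det_fin_three, hJ00, hJ01, hJ02, hJ10, hJ11, hJ12, hJ20, hJ21, hJ22]; ring
  set B : ℝ := max R 1 with hB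
  have hRB : R ≤ B := le_max_left _ _
  have h1B : (1 : ℝ) ≤ B := le_max_right _ _
  have h0B : (0 : ℝ) ≤ B := zero_le_one.trans h1B
  -- the closed subgroup `U(Φ₃)(ℂ)`
  have hUc : IsClosed (unitaryGroupOfForm (starRingEnd ℂ) J : Set (GL (Fin 3) ℂ)) := by
    have h1 : Continuous fun g : GL (Fin 3) ℂ => (g : Matrix (Fin 3) (Fin 3) ℂ) := Units.continuous_val
    exact isClosed_eq (((h1.matrix_map Complex.continuous_conj).matrix_transpose.mul continuous_const).mul h1) continuous_const
  refine ⟨(unitaryGroupOfForm (starRingEnd ℂ) J : Set (GL (Fin 3) ℂ)) ∩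
      {δ : GL (Fin 3) ℂ | ∀ i j, ‖(δ : Matrix (Fin 3) (Fin 3) ℂ) i j‖ ≤ B ∧ ‖((δ⁻¹ : GL (Fin 3) ℂ) : Matrix (Fin 3) (Fin 3) ℂ) i j‖ ≤ B},
    (isCompact_setOf_norm_apply_le_and_inv 3 B).inter_left hUc, Set.inter_subset_left, ?_⟩
  intro g hg hsep hroot
  -- Step 1: diagonalise `g = S diag(d) S⁻¹` in `GL₃(ℂ)`
  obtain ⟨S, d, hS, hSD, hd⟩ :=
    Literature.LinearAlgebra.Matrix.exists_conj_eq_diagonal_of_nodup_roots' (g : Matrix (Fin 3) (Fin 3) ℂ) (Polynomial.nodup_roots hsep)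
  have hdroot : ∀ i, (g : Matrix (Fin 3) (Fin 3) ℂ).charpoly.IsRoot (d i) := fun i => by
    rw [← Polynomial.mem_roots (Matrix.charpoly_monic _).ne_zero, ← hd]
    exact Multiset.mem_map_of_mem _ (Finset.mem_univ_val i)
  have hdle : ∀ i, ‖d i‖ ≤ R := fun i => hroot _ (hdroot i)
  have hdinj : Function.Injective d := by
    intro i j h
    have hnd : (Finset.univ.val.map d).Nodup := by rw [hd]; exact Polynomial.nodup_roots hsep
    exact Multiset.inj_on_of_nodup_map hnd i (Finset.mem_univ_val i) j (Finset.mem_univ_val j) h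
  have hgS : (g : Matrix (Fin 3) (Fin 3) ℂ) * S = S * diagonal d := by
    have h := congrArg (fun M => S * M) hSD
    simpa only [← Matrix.mul_assoc, Matrix.mul_nonsing_inv _ hS, Matrix.one_mul] using h
  have hgJ : ((g : Matrix (Fin 3) (Fin 3) ℂ).map (starRingEnd ℂ))ᵀ * J * (g : Matrix (Fin 3) (Fin 3) ℂ) = J := hg
  -- Step 2: the frame Gram matrix `Q = S̄ᵀ Φ₃ S`, its zero pattern, and the partner involution `d̄ᵢ dⱼ = 1`
  set Q : Matrix (Fin 3) (Fin 3) ℂ := (S.map (starRingEnd ℂ))ᵀ * J * S with hQ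
  have hQ0 : ∀ i j, (starRingEnd ℂ (d i) * d j - 1) * Q i j = 0 := fun i j =>
    sub_one_mul_frameGram_apply_eq_zero (starRingEnd ℂ) hgJ hgS i j
  have hSdet : S.det ≠ 0 := hS.ne_zero
  have hQdet : Q.det ≠ 0 := by
    have hm : (S.map (starRingEnd ℂ)).det = starRingEnd ℂ S.det := by
      rw [← RingHom.mapMatrix_apply, ← RingHom.map_det]
    rw [hQ, det_mul, det_mul, det_transpose, hm, hJdet]
    exact mul_ne_zero (mul_ne_zero ((_root_.map_ne_zero _).2 hSdet) (by norm_num)) hSdet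
  -- every index has a partner (no row of `Q` vanishes)
  have hpair : ∀ i, ∃ j, starRingEnd ℂ (d i) * d j = 1 := by
    intro i
    by_contra h
    push Not at h
    exact hQdet (Matrix.det_eq_zero_of_row_eq_zero i fun j =>
      (mul_eq_zero.1 (hQ0 i j)).resolve_left (sub_ne_zero.2 (h j)))
  -- the partner relation is symmetric, partners are unique
  have hsymm : ∀ i j, starRingEnd ℂ (d i) * d j = 1 → starRingEnd ℂ (d j) * d i = 1 := by
    intro i j h
    have h' := congrArg (starRingEnd ℂ) h
    rwa [map_mul, Complex.conj_conj, map_one, mul_comm] at h'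
  have huniq : ∀ i j j', starRingEnd ℂ (d i) * d j = 1 → starRingEnd ℂ (d i) * d j' = 1 → j = j' := by
    intro i j j' h h'
    have hci : starRingEnd ℂ (d i) ≠ 0 := fun h0 => by rw [h0, zero_mul] at h; exact zero_ne_one h
    exact hdinj (mul_left_cancel₀ hci (h.trans h'.symm))
  have hne : ∀ i, d i ≠ 0 := by
    intro i h0
    obtain ⟨j, hj⟩ := hpair i
    rw [h0, map_zero, zero_mul] at hj
    exact zero_ne_one hj
  have hnorm1 : ∀ i, starRingEnd ℂ (d i) * d i = 1 → ‖d i‖ = 1 := by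
    intro i h
    have h' := congrArg (fun z : ℂ => ‖z‖) h
    simp only [norm_mul, RCLike.norm_conj, norm_one] at h'
    rcases mul_self_eq_one_iff.1 h' with h'' | h''
    · exact h''
    · linarith [norm_nonneg (d i)]
  have hnormmul : ∀ i j, starRingEnd ℂ (d i) * d j = 1 → ‖d i‖ * ‖d j‖ = 1 := by
    intro i j h
    have h' := congrArg (fun z : ℂ => ‖z‖) h
    simpa only [norm_mul, RCLike.norm_conj, norm_one] using h'
  -- the `GL₃(ℂ)`-conjugate `D = S⁻¹ g S` with matrix `diag(d)` and inverse matrix `diag(d⁻¹)`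
  set Su : GL (Fin 3) ℂ := Matrix.nonsingInvUnit S hS with hSu
  have hSu_val : ((Su : GL (Fin 3) ℂ) : Matrix (Fin 3) (Fin 3) ℂ) = S := rfl
  have hSu_inv : ((Su⁻¹ : GL (Fin 3) ℂ) : Matrix (Fin 3) (Fin 3) ℂ) = S⁻¹ := rfl
  set D : GL (Fin 3) ℂ := Su⁻¹ * g * Su with hD
  have hDval : ((D : GL (Fin 3) ℂ) : Matrix (Fin 3) (Fin 3) ℂ) = diagonal d := by
    rw [hD, Units.val_mul, Units.val_mul, hSu_val, hSu_inv]; exact hSD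
  have hgD : IsConj g D := isConj_iff.2 ⟨Su⁻¹, by rw [hD, inv_inv]⟩
  have hDinv : ((D⁻¹ : GL (Fin 3) ℂ) : Matrix (Fin 3) (Fin 3) ℂ) = diagonal fun i => (d i)⁻¹ := by
    rw [Matrix.coe_units_inv, hDval]
    refine Matrix.inv_eq_left_inv ?_
    rw [diagonal_mul_diagonal]
    convert diagonal_one with i
    exact inv_mul_cancel₀ (hne i)
  by_cases hell : ∀ i, starRingEnd ℂ (d i) * d i = 1
  · /- CASE (1) — compact Cartan `T_c ≅ U(1)³`: all `|dᵢ| = 1`; representative `M(d₀, d₁, d₂) = P diag(d) P⁻¹` -/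
    have hu : ∀ i, ‖d i‖ = 1 := fun i => hnorm1 i (hell i)
    -- the representative as a unit, with inverse `M(d₀⁻¹, d₁⁻¹, d₂⁻¹)`
    set δ : GL (Fin 3) ℂ :=
      ⟨!![(d 0 + d 2) / 2, 0, (d 0 - d 2) / 2; 0, d 1, 0; (d 0 - d 2) / 2, 0, (d 0 + d 2) / 2],
        !![((d 0)⁻¹ + (d 2)⁻¹) / 2, 0, ((d 0)⁻¹ - (d 2)⁻¹) / 2; 0, (d 1)⁻¹, 0; ((d 0)⁻¹ - (d 2)⁻¹) / 2, 0, ((d 0)⁻¹ + (d 2)⁻¹) / 2],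
        by rw [compactTorusRep₃_mul, mul_inv_cancel₀ (hne 0), mul_inv_cancel₀ (hne 1), mul_inv_cancel₀ (hne 2)]; exact compactTorusRep₃_one,
        by rw [compactTorusRep₃_mul, inv_mul_cancel₀ (hne 0), inv_mul_cancel₀ (hne 1), inv_mul_cancel₀ (hne 2)]; exact compactTorusRep₃_one⟩ with hδ
    have hδval : ((δ : GL (Fin 3) ℂ) : Matrix (Fin 3) (Fin 3) ℂ) =
        !![(d 0 + d 2) / 2, 0, (d 0 - d 2) / 2; 0, d 1, 0; (d 0 - d 2) / 2, 0, (d 0 + d 2) / 2] := rfl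
    have hδinv : ((δ⁻¹ : GL (Fin 3) ℂ) : Matrix (Fin 3) (Fin 3) ℂ) =
        !![((d 0)⁻¹ + (d 2)⁻¹) / 2, 0, ((d 0)⁻¹ - (d 2)⁻¹) / 2; 0, (d 1)⁻¹, 0; ((d 0)⁻¹ - (d 2)⁻¹) / 2, 0, ((d 0)⁻¹ + (d 2)⁻¹) / 2] := rfl
    -- `δ ∈ U(Φ₃)(ℂ)`
    have hδmem : δ ∈ unitaryGroupOfForm (starRingEnd ℂ) J := by
      rw [mem_unitaryGroupOfForm_iff, hδval, hJ]
      exact conjTranspose_compactTorusRep₃_mul (hell 0) (hell 1) (hell 2)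
    -- `D ∼ δ` through the frame `P = (1,0,1; 0,1,0; 1,0,−1)`
    have hPdet : (!![(1 : ℂ), 0, 1; 0, 1, 0; 1, 0, -1] : Matrix (Fin 3) (Fin 3) ℂ).det ≠ 0 := by
      simp [Matrix.det_fin_three]; norm_num
    set Pu : GL (Fin 3) ℂ := Matrix.nonsingInvUnit (!![(1 : ℂ), 0, 1; 0, 1, 0; 1, 0, -1]) (isUnit_iff_ne_zero.2 hPdet) with hPu
    have hPu_val : ((Pu : GL (Fin 3) ℂ) : Matrix (Fin 3) (Fin 3) ℂ) = !![(1 : ℂ), 0, 1; 0, 1, 0; 1, 0, -1] := rfl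
    have hDδ : IsConj D δ := by
      refine isConj_iff.2 ⟨Pu, ?_⟩
      rw [mul_inv_eq_iff_eq_mul]
      apply Units.ext
      show (Pu : Matrix (Fin 3) (Fin 3) ℂ) * (D : Matrix (Fin 3) (Fin 3) ℂ) = (δ : Matrix (Fin 3) (Fin 3) ℂ) * (Pu : Matrix (Fin 3) (Fin 3) ℂ)
      rw [hPu_val, hDval, hδval]
      ext i j
      fin_cases i <;> fin_cases j <;> simp [Matrix.mul_apply, Fin.sum_univ_three, diagonal] <;> ring
    refine ⟨δ, ⟨hδmem, fun i j => ⟨?_, ?_⟩⟩, hgD.trans hDδ⟩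
    · rw [hδval]; exact (norm_compactTorusRep₃_apply_le_one (hu 0) (hu 1) (hu 2) i j).trans h1B
    · rw [hδinv]
      refine (norm_compactTorusRep₃_apply_le_one ?_ ?_ ?_ i j).trans h1B
      · rw [norm_inv, hu 0, inv_one]
      · rw [norm_inv, hu 1, inv_one]
      · rw [norm_inv, hu 2, inv_one]
  · /- CASE (0) — the Cartan `T_s ≅ ℂˣ × U(1)`: one index `k` is not self-partnered; its partner `j ≠ k`, the third index `l` is self-partnered;
       representative `diag(d_k, d_l, d_j)`, reached from `diag(d)` by a permutation matrix -/
    push Not at hell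
    obtain ⟨k, hk⟩ := hell
    obtain ⟨j, hkj⟩ := hpair k
    have hjk : starRingEnd ℂ (d j) * d k = 1 := hsymm k j hkj
    have hj_ne_k : j ≠ k := by
      rintro rfl
      exact hk hkj
    -- the third index
    have hthird : ∀ a b : Fin 3, ∃ c : Fin 3, c ≠ a ∧ c ≠ b := by decide
    obtain ⟨l, hl_ne_k, hl_ne_j⟩ := hthird k j
    obtain ⟨m, hlm⟩ := hpair l
    have hm_ne_k : m ≠ k := by
      intro hmk
      -- `d̄_l d_k = 1` and `d̄_k d_j = 1` ⇒ (symmetrise) `d̄_k d_l = 1 = d̄_k d_j` ⇒ `l = j`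
      rw [hmk] at hlm
      exact hl_ne_j (huniq k l j (hsymm l k hlm) hkj)
    have hm_ne_j : m ≠ j := by
      intro hmj
      -- `d̄_l d_j = 1` and `d̄_j d_k = 1` ⇒ `d̄_j d_l = 1 = d̄_j d_k` ⇒ `l = k`
      rw [hmj] at hlm
      exact hl_ne_k (huniq j l k (hsymm l j hlm) hjk)
    have huniq3 : ∀ a b c x : Fin 3, b ≠ a → c ≠ a → c ≠ b → x ≠ a → x ≠ b → x = c := by decide
    have hml : m = l := huniq3 k j l m hj_ne_k hl_ne_k hl_ne_j hm_ne_k hm_ne_j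
    have hll : starRingEnd ℂ (d l) * d l = 1 := by rw [hml] at hlm; exact hlm
    -- sizes
    have hnl : ‖d l‖ = 1 := hnorm1 l hll
    have hkjn : ‖d k‖ * ‖d j‖ = 1 := hnormmul k j hkj
    have hkB : ‖d k‖ ≤ B := (hdle k).trans hRB
    have hjB : ‖d j‖ ≤ B := (hdle j).trans hRB
    have hlB : ‖d l‖ ≤ B := hnl.le.trans h1B
    have hkiB : ‖d k‖⁻¹ ≤ B := by
      rw [inv_eq_of_mul_eq_one_right hkjn]; exact hjB
    have hjiB : ‖d j‖⁻¹ ≤ B := by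
      rw [mul_comm] at hkjn
      rw [inv_eq_of_mul_eq_one_right hkjn]; exact hkB
    have hliB : ‖d l‖⁻¹ ≤ B := by
      rw [hnl, inv_one]; exact h1B
    -- the permutation `σ = (k, l, j)` of `Fin 3`
    have hinj3 : ∀ a b c : Fin 3, a ≠ b → a ≠ c → b ≠ c → Function.Injective ![a, b, c] := by decide
    set σ : Equiv.Perm (Fin 3) :=
      Equiv.ofBijective ![k, l, j] (Finite.injective_iff_bijective.1 (hinj3 k l j hl_ne_k.symm hj_ne_k.symm hl_ne_j)) with hσ
    have hσ0 : σ 0 = k := by simp [hσ]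
    have hσ1 : σ 1 = l := by simp [hσ]
    have hσ2 : σ 2 = j := by simp [hσ]
    obtain ⟨δ, hδval, hδinv, hDδ⟩ := exists_units_diagonal_comp_perm D hDval hDinv σ
    have hδval' : ((δ : GL (Fin 3) ℂ) : Matrix (Fin 3) (Fin 3) ℂ) = diagonal ![d k, d l, d j] := by
      rw [hδval]
      congr 1
      funext i
      fin_cases i <;> simp [hσ0, hσ1, hσ2]
    have hδinv' : ((δ⁻¹ : GL (Fin 3) ℂ) : Matrix (Fin 3) (Fin 3) ℂ) = diagonal ![(d k)⁻¹, (d l)⁻¹, (d j)⁻¹] := by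
      rw [hδinv]
      congr 1
      funext i
      fin_cases i <;> simp [hσ0, hσ1, hσ2]
    -- `δ = diag(d_k, d_l, d_j) ∈ U(Φ₃)(ℂ)`: `d̄_k d_j = 1`, `d̄_l d_l = 1`, `d̄_j d_k = 1`
    have hδmem : δ ∈ unitaryGroupOfForm (starRingEnd ℂ) J := by
      rw [mem_unitaryGroupOfForm_iff, hδval', diagonal_map (map_zero _), diagonal_transpose]
      ext i x
      fin_cases i <;> fin_cases x <;>
        simp [Matrix.mul_apply, diagonal, hJ00, hJ01, hJ02, hJ10, hJ11, hJ12, hJ20, hJ21, hJ22, hkj, hll, hjk]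
    refine ⟨δ, ⟨hδmem, fun i x => ⟨?_, ?_⟩⟩, hgD.trans hDδ⟩
    · rw [hδval']
      fin_cases i <;> fin_cases x <;> simp [diagonal, h0B, hkB, hlB, hjB]
    · rw [hδinv']
      fin_cases i <;> fin_cases x <;> simp [diagonal, h0B, hkiB, hliB, hjiB]

end Engine

end Literature.NumberTheory.Rogawski1990

end
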